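import Summits.RiemannHypothesis.RiemannHypothesis.Theorems.TiltedLandingLaw421R3GainTwoPoint
import Summits.RiemannHypothesis.RiemannHypothesis.Theorems.TiltedLandingLaw421R3GainSegment

/-!
# W-09 far branch · «FarPricing» — (E): the imaginary part of the far remainder IS the far pull (C4 kernel desk rh-idea-6 g43)

SUPPORT (K only; asserts no law; RH is NOT proved; ⟨33346⟩/⟨33347⟩ OPEN).  TWO imports, both landed: ★ «FarTwoPoint» (#1251,
`RhW08.GainTwoPoint.farList_twoPoint`: the complete far list `(aᵢ)` of a simple `R/2`-isolated state `v` with the EXACT two-point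
identity `lineRem z − lineRem z' = Σ'ᵢ (1/(z − aᵢ) − 1/(z' − aᵢ))` between non-zeros of the open upper half-plane) and «GainSegment»
(#1245, for `RhW08.GainSegment.differentiableAt_lineRem`, cited by name).

CONTENT = the equality row (E) of C3's η-free sink certificate (rh-idea-3 g54 LPGAIN §1 / g55 TWOPOINT-SINK §1–§4, DESIGN NOTE 6;
named there as the ONE tree identity still missing after #1251): in the local model `Σ_u m_u·(−Im K_u(w)) = Q` — «the tilt is real».
★★ `im_lineRem_eq_farPull`: on a legal frame, for a simple isolated state `v`, at EVERY non-zero `z` of `f⁽ʲ⁾` with `0 < Im z` in the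
slab `|Re z − Re v| ≤ R/3` (⊇ the axis box: `hmax < R/3`):  `Im lineRem f j v R z = Σ'ᵢ Im 1/(z − aᵢ)` (absolutely summable), over the
SAME list that carries the two-point identity and the multiplicity export (both re-exported, so one `obtain` serves a whole certificate);
at a child (`f⁽ʲ⁺¹⁾(z) = 0`) this reads `Σ'ᵢ Im 1/(z − aᵢ) = −Im((z − v)⁻¹ + (z − v̄)⁻¹) = −Q`.
PROOF (§3; one order beyond the two-point law, no Hadamard constant): `Φ := Im lineRem − pull` is locally constant on upper-half-plane
non-zeros (#1251, imaginary parts; the pulls are separately summable by `Σ 1/‖z − aᵢ‖² < ∞` and the strip `|Im aᵢ| ≤ Hs` of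
`RhW08.Column.abs_im_le_of_level`), reflection-ODD (`f` real; multiplicities reflection-symmetric by `analyticOrderAt_conj_eq`), and continuous
across the real point `Re v` (no zero of `f⁽ʲ⁾` within `Im v` of it, by isolation; dominated `continuousOn_tsum`) — so `Φ = 0`.
§1 frame facts (reflection of `levelField` / `farFieldAt` / `Im lineRem`); §2 the pull series (geometry of far sources seen from the
slab, domination, ★ `farPull_summable_continuousOn`, ★ `farPull_conj`); §4 ★ `tsum_conj_eq` (re-pairing `Σ' g(āᵢ) = Σ' g(aᵢ)`: folds the
tree's list into C3's paired kernels) and ★ `tsum_nonpos_of_paired`: a reflection-PAIRED pointwise inequality `h(c) + h(c̄) ≤ 0` sums to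
`Σ'ᵢ h(aᵢ) ≤ 0` over the list (the form in which C3's kernel lemma (K) is true: corner sources need their conjugates).  LEFT to the certificate's own file: (K) the closed-form kernel inequality on the far strip, (D) the datum
inequality, (S) the two real-part seam reads, and the three-line assembly to `FarFieldModulusLawBoxPl` (C3 g55 §4).
No def, no twin of an importable statement (tree facts cited by name: `lineRem_eq_farFieldAt_of_simple`, `farFieldAt_child`,
`iteratedDeriv_conj`, `analyticOrderAt_conj_eq`, `RhW08.Column.abs_im_le_of_level`, `RhW08.GainSegment.differentiableAt_lineRem`,
`RhW08.ClusterQ.R_pos_of_engine`).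
-/

noncomputable section

namespace RhW08.FarPricing

open Complex Filter Topology Set
open scoped ComplexConjugate
open RhW08.Round1 RhW08.StSwap RhW08.Round2 RhW08.QuadW
open RhW08.SealSwap (PBot)
open RhW08.SealSwapQ RhW08.RateSplit RhW08.IsolatedTilt RhW08.FarStep RhW08.BurgersRate RhW08.PurseP RhW08.BurgersRateG3
open RhIdea6.G17.W07C7 RhIdea6.G17.W07C7.Rev6 RhIdea6.G18.W07C8.Law421BirthS RhIdea6.G19.W07C11.Seam
open RhIdea6.G20.W07C12.Frac RhIdea6.G20.W07C12.StColP RhW07.C12.FieldSplit RhIdea6.G21.W07C13.TentMax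
open RhW07.C14.TwoSided RhW07.C14.Classes RhW07.C14.Lineage RhW07.C14.Booking
open RhW08.FLink RhW08.FLinkGain RhW08.FLinkGainSeam
open RhW08.GainTwoPoint

/-! ## §1 Frame facts: reflection of the level field, the far field and the far remainder -/

/-- (K) reflection of the level field: `φ_j(p̄) = conj φ_j(p)`. -/
theorem levelField_conj {η : ℝ} {f : ℂ → ℂ} {x₀ s hmax R Hs : ℝ} {B : ℕ} (hE : EngineHyps5 2 η f x₀ s hmax R Hs B) (j : ℕ) (p : ℂ) :
    levelField f j (conj p) = conj (levelField f j p) := by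
  rw [levelField, levelField, iteratedDeriv_conj hE, iteratedDeriv_conj hE, map_div₀]

/-- (K) reflection of the far field: `farFieldAt v p̄ = conj (farFieldAt v p)` (the pair `{v, v̄}` is reflection-symmetric). -/
theorem farFieldAt_conj {η : ℝ} {f : ℂ → ℂ} {x₀ s hmax R Hs : ℝ} {B : ℕ} (hE : EngineHyps5 2 η f x₀ s hmax R Hs B) (j : ℕ) (v p : ℂ) :
    farFieldAt f j v (conj p) = conj (farFieldAt f j v p) := by
  rw [farFieldAt, farFieldAt, levelField_conj hE]
  simp only [map_sub, map_div₀, map_one, Complex.conj_conj]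
  ring

/-- (K) hence, on a SIMPLE isolated state, the far remainder is reflection-odd in its imaginary part: `Im lineRem(p̄) = −Im lineRem(p)`. -/
theorem im_lineRem_conj {η : ℝ} {f : ℂ → ℂ} {x₀ s hmax R Hs : ℝ} {B : ℕ} (hE : EngineHyps5 2 η f x₀ s hmax R Hs B)
    {j : ℕ} {v : ℂ} (hFv : iteratedDeriv j f v = 0) (hs : iteratedDeriv (j + 1) f v ≠ 0) (hv0 : 0 < v.im)
    (hiso : ∀ z : ℂ, iteratedDeriv j f z = 0 → |z.re - v.re| < R / 2 → z = v ∨ z = conj v) (p : ℂ) :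
    (lineRem f j v R (conj p)).im = -(lineRem f j v R p).im := by
  rw [lineRem_eq_farFieldAt_of_simple hE hFv hs hv0 hiso, lineRem_eq_farFieldAt_of_simple hE hFv hs hv0 hiso, farFieldAt_conj hE,
    Complex.conj_im]

/-! ## §2 The far pull series `p ↦ Σᵢ Im 1/(p − aᵢ)` over a far list: geometry, summability, continuity, reflection -/

/-- (K) a far source seen from the slab `|Re p − Re v| ≤ R/3` is at distance `≥ R/6`. -/
theorem norm_sub_far_ge {v p a : ℂ} {R : ℝ} (ha : R / 2 ≤ |a.re - v.re|) (hp : |p.re - v.re| ≤ R / 3) : R / 6 ≤ ‖p - a‖ := by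
  have h1 : |a.re - v.re| ≤ |p.re - a.re| + |p.re - v.re| := by
    have h := abs_sub_le a.re p.re v.re
    rwa [abs_sub_comm a.re p.re] at h
  have h2 : |p.re - a.re| ≤ ‖p - a‖ := by simpa using Complex.abs_re_le_norm (p - a)
  linarith

/-- (K) … so distances to far sources from two points of the picture are comparable: `‖w − a‖ ≤ (1 + 6‖w − p‖/R)·‖p − a‖`. -/
theorem norm_sub_far_le {v w p a : ℂ} {R : ℝ} (hR : 0 < R) (ha : R / 2 ≤ |a.re - v.re|) (hp : |p.re - v.re| ≤ R / 3) :
    ‖w - a‖ ≤ (1 + 6 * ‖w - p‖ / R) * ‖p - a‖ := by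
  have h6 := norm_sub_far_ge ha hp
  have htri : ‖w - a‖ ≤ ‖w - p‖ + ‖p - a‖ := norm_sub_le_norm_sub_add_norm_sub w p a
  have hk : ‖w - p‖ ≤ 6 * ‖w - p‖ / R * ‖p - a‖ := by
    rw [div_mul_eq_mul_div, le_div_iff₀ hR]
    nlinarith [norm_nonneg (w - p)]
  nlinarith [norm_nonneg (p - a)]

/-- (K) the pull of ONE far source of the strip at a slab point, dominated through the reference point `w`:
`|Im 1/(p − a)| ≤ (|Im p| + Hs)·(1 + 6‖w − p‖/R)² / ‖w − a‖²`. -/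
theorem abs_im_one_div_sub_le {v w p a : ℂ} {R Hs : ℝ} (hR : 0 < R) (ha : R / 2 ≤ |a.re - v.re|) (haHs : |a.im| ≤ Hs)
    (hp : |p.re - v.re| ≤ R / 3) (hwa : w ≠ a) :
    |(1 / (p - a)).im| ≤ (|p.im| + Hs) * (1 + 6 * ‖w - p‖ / R) ^ 2 * (1 / (‖w - a‖ * ‖w - a‖)) := by
  have h6 := norm_sub_far_ge ha hp
  have hpa : 0 < ‖p - a‖ := by linarith
  have hwa' : 0 < ‖w - a‖ := norm_pos_iff.2 (sub_ne_zero.2 hwa)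
  have hK := norm_sub_far_le (w := w) hR ha hp
  set K : ℝ := 1 + 6 * ‖w - p‖ / R with hKdef
  have hK0 : 0 ≤ K := by rw [hKdef]; positivity
  -- `|Im 1/(p − a)| = |Im (p − a)| / ‖p − a‖²`
  have him : |(1 / (p - a)).im| = |(p - a).im| / (‖p - a‖ * ‖p - a‖) := by
    rw [one_div, Complex.inv_im, abs_div, abs_neg, Complex.normSq_eq_norm_sq, pow_two, abs_of_pos (mul_pos hpa hpa)]
  have hnum : |(p - a).im| ≤ |p.im| + Hs := by
    rw [Complex.sub_im]
    exact (abs_sub _ _).trans (by linarith)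
  -- `1/‖p − a‖² ≤ K²/‖w − a‖²`
  have hden : 1 / (‖p - a‖ * ‖p - a‖) ≤ K ^ 2 * (1 / (‖w - a‖ * ‖w - a‖)) := by
    rw [mul_one_div, div_le_div_iff₀ (mul_pos hpa hpa) (mul_pos hwa' hwa'), one_mul, pow_two]
    have h := mul_le_mul hK hK (norm_nonneg _) (mul_nonneg hK0 (norm_nonneg (p - a)))
    calc ‖w - a‖ * ‖w - a‖ ≤ K * ‖p - a‖ * (K * ‖p - a‖) := h
      _ = K * K * (‖p - a‖ * ‖p - a‖) := by ring
  have hHs0 : 0 ≤ Hs := (abs_nonneg _).trans haHs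
  rw [him, div_eq_mul_one_div]
  calc |(p - a).im| * (1 / (‖p - a‖ * ‖p - a‖))
      ≤ (|p.im| + Hs) * (K ^ 2 * (1 / (‖w - a‖ * ‖w - a‖))) :=
        mul_le_mul hnum hden (by positivity) (add_nonneg (abs_nonneg _) hHs0)
    _ = (|p.im| + Hs) * K ^ 2 * (1 / (‖w - a‖ * ‖w - a‖)) := by ring

/-- ★ (K) SUMMABILITY AND CONTINUITY OF THE FAR PULL on a bounded piece `S` of the slab: if `Σᵢ 1/‖w − aᵢ‖² < ∞` at one reference
point `w ∉ {aᵢ}` (★ of «FarTwoPoint» gives this at every non-zero of the open upper half-plane), then `p ↦ Σᵢ Im 1/(p − aᵢ)` is absolutely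
summable at every point of `S` and continuous on `S` (dominated convergence, `continuousOn_tsum`). -/
theorem farPull_summable_continuousOn {ι : Type} {a : ι → ℂ} {v w : ℂ} {R Hs H D : ℝ} (hR : 0 < R) (hHs : 0 ≤ Hs) (hH : 0 ≤ H)
    (hfar : ∀ i, R / 2 ≤ |(a i).re - v.re|) (hstrip : ∀ i, |(a i).im| ≤ Hs) (hwa : ∀ i, w ≠ a i)
    (hsum : Summable (fun i ↦ 1 / (‖w - a i‖ * ‖w - a i‖))) {S : Set ℂ}
    (hS : ∀ p ∈ S, |p.re - v.re| ≤ R / 3 ∧ |p.im| ≤ H ∧ ‖w - p‖ ≤ D) :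
    (∀ p ∈ S, Summable (fun i ↦ (1 / (p - a i)).im)) ∧ ContinuousOn (fun p ↦ ∑' i, (1 / (p - a i)).im) S := by
  have hD : ∀ p ∈ S, 0 ≤ D := fun p hp ↦ (norm_nonneg _).trans (hS p hp).2.2
  set u : ι → ℝ := fun i ↦ (H + Hs) * (1 + 6 * D / R) ^ 2 * (1 / (‖w - a i‖ * ‖w - a i‖)) with hu
  have hus : Summable u := hsum.mul_left _
  have hbound : ∀ i, ∀ p ∈ S, ‖(1 / (p - a i)).im‖ ≤ u i := by
    intro i p hp
    obtain ⟨hpre, hpim, hpD⟩ := hS p hp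
    rw [Real.norm_eq_abs]
    refine (abs_im_one_div_sub_le hR (hfar i) (hstrip i) hpre (hwa i)).trans ?_
    have hK : 1 + 6 * ‖w - p‖ / R ≤ 1 + 6 * D / R := by
      have := div_le_div_of_nonneg_right (mul_le_mul_of_nonneg_left hpD (by norm_num : (0 : ℝ) ≤ 6)) hR.le
      linarith
    have hK0 : 0 ≤ 1 + 6 * ‖w - p‖ / R := by positivity
    have hsq : (1 + 6 * ‖w - p‖ / R) ^ 2 ≤ (1 + 6 * D / R) ^ 2 := pow_le_pow_left₀ hK0 hK 2
    have hHp : |p.im| + Hs ≤ H + Hs := by linarith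
    exact mul_le_mul (mul_le_mul hHp hsq (by positivity) (by positivity)) le_rfl (by positivity) (by positivity)
  refine ⟨fun p hp ↦ Summable.of_norm_bounded hus (fun i ↦ hbound i p hp), ?_⟩
  refine continuousOn_tsum (fun i ↦ ?_) hus hbound
  have hne : ∀ p ∈ S, p - a i ≠ 0 := by
    intro p hp h0
    have h6 := norm_sub_far_ge (hfar i) (hS p hp).1
    rw [h0, norm_zero] at h6
    linarith
  exact Complex.continuous_im.comp_continuousOn ((continuousOn_const).div (continuousOn_id.sub continuousOn_const) hne)

/-- ★ (K) REFLECTION-ODDNESS OF THE FAR PULL: if the list re-indexes every weighted sum as a sum over `ℂ` against a reflection-symmetric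
multiplicity `n` (★ of «FarTwoPoint» exports exactly this, with `n(c̄) = n(c)` by `RhW08.FLinkGain.analyticOrderAt_conj_eq`), then
`Σᵢ Im 1/(p̄ − aᵢ) = −Σᵢ Im 1/(p − aᵢ)` — in particular the far pull VANISHES at real points. -/
theorem farPull_conj {ι : Type} {a : ι → ℂ} {n : ℂ → ℝ} (hn : ∀ c, n (conj c) = n c)
    (hexp : ∀ g : ℂ → ℝ, Summable (fun i ↦ g (a i)) → HasSum (fun c : ℂ ↦ n c * g c) (∑' i, g (a i)))
    {p : ℂ} (hp : Summable (fun i ↦ (1 / (p - a i)).im)) (hcp : Summable (fun i ↦ (1 / (conj p - a i)).im)) :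
    ∑' i, (1 / (conj p - a i)).im = -∑' i, (1 / (p - a i)).im := by
  rw [← (hexp (fun c ↦ (1 / (p - c)).im) hp).tsum_eq, ← (hexp (fun c ↦ (1 / (conj p - c)).im) hcp).tsum_eq, ← tsum_neg,
    ← Equiv.tsum_eq Complex.conjCLE.toEquiv (fun c ↦ n c * (1 / (conj p - c)).im)]
  refine tsum_congr fun c ↦ ?_
  have hc : (Complex.conjCLE.toEquiv c : ℂ) = conj c := rfl
  rw [hc, hn, ← map_sub, ← map_one conj, ← map_div₀, Complex.conj_im, map_one]
  ring

/-! ## §3 (E) THE IMAGINARY PART OF THE FAR REMAINDER IS THE FAR PULL -/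

/-- ★★ (K) **(E) — `Im lineRem(z) = Σᵢ Im 1/(z − aᵢ)`** over the complete far list of ★ `RhW08.GainTwoPoint.farList_twoPoint`, re-exported
here with its completeness / multiplicity / export / two-point clauses so that ONE list serves a whole certificate; at every non-zero `z` of
`f⁽ʲ⁾` with `0 < Im z`, `|Re z − Re v| ≤ R/3` the pull is absolutely summable and equals `Im lineRem(z)`; at a child it is `−Im K_v(z)`.
Proof: module docstring (constancy by the two-point identity · reflection-oddness · continuity across the real point `Re v`). -/
theorem im_lineRem_eq_farPull {η : ℝ} {f : ℂ → ℂ} {x₀ s hmax R Hs : ℝ} {B : ℕ} (hE : EngineHyps5 2 η f x₀ s hmax R Hs B)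
    {j : ℕ} {v : ℂ} (hFv : iteratedDeriv j f v = 0) (hv0 : 0 < v.im) (hs : iteratedDeriv (j + 1) f v ≠ 0)
    (hiso : ∀ z : ℂ, iteratedDeriv j f z = 0 → |z.re - v.re| < R / 2 → z = v ∨ z = conj v) :
    ∃ (ι : Type) (a : ι → ℂ), (∀ i, iteratedDeriv j f (a i) = 0 ∧ R / 2 ≤ |(a i).re - v.re|) ∧
      (∀ z, iteratedDeriv j f z = 0 → z ≠ v → z ≠ conj v → ∃ i, z = a i) ∧
      (∀ c, c ≠ v → c ≠ conj v → {i | a i = c}.ncard = analyticOrderNatAt (iteratedDeriv j f) c) ∧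
      (∀ g : ℂ → ℝ, Summable (fun i ↦ g (a i)) → HasSum (fun c : ℂ ↦
        (if c = v ∨ c = conj v then (0 : ℝ) else (analyticOrderNatAt (iteratedDeriv j f) c : ℝ)) * g c) (∑' i, g (a i))) ∧
      (∀ z z' : ℂ, iteratedDeriv j f z ≠ 0 → 0 < z.im → iteratedDeriv j f z' ≠ 0 → 0 < z'.im →
        Summable (fun i ↦ (1 / (z - a i) - 1 / (z' - a i))) ∧
          lineRem f j v R z - lineRem f j v R z' = ∑' i, (1 / (z - a i) - 1 / (z' - a i))) ∧
      ∀ z : ℂ, iteratedDeriv j f z ≠ 0 → 0 < z.im → |z.re - v.re| ≤ R / 3 →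
        Summable (fun i ↦ (1 / (z - a i)).im) ∧ (lineRem f j v R z).im = ∑' i, (1 / (z - a i)).im ∧
          (iteratedDeriv (j + 1) f z = 0 → ∑' i, (1 / (z - a i)).im = (-((z - v)⁻¹ + (z - conj v)⁻¹)).im) := by
  obtain ⟨ι, a, m, -, hm1, hfar, hcomplete, hcount, hexp, htwo⟩ := farList_twoPoint hE hFv hv0 hs hiso
  have hR : 0 < R := RhW08.ClusterQ.R_pos_of_engine hE
  have hHs : 0 ≤ Hs := hE.2.2.2.2.2.2.2.1
  -- the export with weights `m = 1`, against the reflection-symmetric multiplicity `n`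
  set n : ℂ → ℝ := fun c ↦ (if c = v ∨ c = conj v then (0 : ℝ) else (analyticOrderNatAt (iteratedDeriv j f) c : ℝ)) with hndef
  have hexp' : ∀ g : ℂ → ℝ, Summable (fun i ↦ g (a i)) → HasSum (fun c : ℂ ↦ n c * g c) (∑' i, g (a i)) := by
    intro g hg
    have h := hexp g (by simpa only [hm1, one_mul] using hg)
    simpa only [hm1, one_mul] using h
  have hn : ∀ c, n (conj c) = n c := by
    intro c
    have h1 : (conj c = v ∨ conj c = conj v) ↔ (c = v ∨ c = conj v) := by
      constructor
      · rintro (h | h)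
        · exact Or.inr (by rw [← h, conj_conj])
        · exact Or.inl (by simpa using congrArg conj h)
      · rintro (h | h)
        · exact Or.inr (by rw [h])
        · exact Or.inl (by rw [h, conj_conj])
    simp only [hndef, h1, analyticOrderNatAt, analyticOrderAt_conj_eq hE]
  refine ⟨ι, a, hfar, hcomplete, hcount, hexp', fun z z' hz hzi hz' hz'i ↦ (htwo z z' hz hzi hz' hz'i).2, ?_⟩
  intro z hz hzim hzre
  have hza : ∀ i, z ≠ a i := fun i h ↦ hz (by rw [h]; exact (hfar i).1)
  have hne : iteratedDeriv j f ≠ 0 := fun h ↦ hz (by rw [h]; rfl)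
  have hstripa : ∀ i, |(a i).im| ≤ Hs := fun i ↦ RhW08.Column.abs_im_le_of_level hE hne (hfar i).1
  have hfar' : ∀ i, R / 2 ≤ |(a i).re - v.re| := fun i ↦ (hfar i).2
  -- reference summability `Σ 1/‖z − aᵢ‖² < ∞`: ★ at the pair `(z, z)`
  have hsum2 : Summable (fun i ↦ 1 / (‖z - a i‖ * ‖z - a i‖)) := by
    simpa only [hm1] using (htwo z z hz hzim hz hzim).1.1
  -- the bounded slab piece `S ∋ z`, containing the ball `‖p − Re v‖ < r` together with its reflection
  set x : ℂ := (v.re : ℂ) with hxdef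
  set r : ℝ := min (R / 3) (v.im / 2) with hrdef
  have hr0 : 0 < r := lt_min (by linarith) (by linarith)
  have hrR : r ≤ R / 3 := min_le_left _ _
  have hrv : r ≤ v.im / 2 := min_le_right _ _
  set H : ℝ := max |z.im| r with hHdef
  set D : ℝ := ‖z - x‖ + r with hDdef
  have hH0 : 0 ≤ H := (abs_nonneg _).trans (le_max_left _ _)
  set S : Set ℂ := {p : ℂ | |p.re - v.re| ≤ R / 3 ∧ |p.im| ≤ H ∧ ‖z - p‖ ≤ D} with hSdef
  obtain ⟨hsumS, hcontS⟩ :=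
    farPull_summable_continuousOn (S := S) hR hHs hH0 hfar' hstripa hza hsum2 (fun p hp ↦ hp)
  have hzS : z ∈ S := ⟨hzre, le_max_left _ _, by rw [sub_self, norm_zero, hDdef]; positivity⟩
  have hvx : v - x = ((v.im : ℝ) : ℂ) * I := Complex.ext (by simp [hxdef]) (by simp [hxdef])
  have hcvx : conj v - x = -(((v.im : ℝ) : ℂ) * I) := Complex.ext (by simp [hxdef]) (by simp [hxdef])
  have hnvx : ‖v - x‖ = v.im := by
    rw [hvx, norm_mul, Complex.norm_real, Complex.norm_I, mul_one, Real.norm_eq_abs, abs_of_pos hv0]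
  have hncvx : ‖conj v - x‖ = v.im := by
    rw [hcvx, norm_neg, norm_mul, Complex.norm_real, Complex.norm_I, mul_one, Real.norm_eq_abs, abs_of_pos hv0]
  have hball : ∀ p : ℂ, ‖p - x‖ < r → p ∈ S ∧ conj p ∈ S ∧ iteratedDeriv j f p ≠ 0 ∧ p ≠ v ∧ p ≠ conj v := by
    intro p hp
    have hre : |p.re - v.re| ≤ R / 3 := by
      have h := Complex.abs_re_le_norm (p - x)
      rw [Complex.sub_re, hxdef, Complex.ofReal_re] at h
      linarith
    have him : |p.im| ≤ H := by
      have h := Complex.abs_im_le_norm (p - x)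
      rw [Complex.sub_im, hxdef, Complex.ofReal_im, sub_zero] at h
      exact le_max_of_le_right (h.trans hp.le)
    have hdist : ‖z - p‖ ≤ D := by
      have h := norm_sub_le_norm_sub_add_norm_sub z x p
      rw [norm_sub_rev x p] at h
      rw [hDdef]
      linarith
    have hpv : p ≠ v := fun h ↦ by rw [h, hnvx] at hp; linarith
    have hpcv : p ≠ conj v := fun h ↦ by rw [h, hncvx] at hp; linarith
    have hp0 : iteratedDeriv j f p ≠ 0 := fun h0 ↦ (hiso p h0 (by linarith)).elim hpv hpcv
    have hcdist : ‖z - conj p‖ ≤ D := by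
      have h := norm_sub_le_norm_sub_add_norm_sub z x (conj p)
      have hxc : ‖x - conj p‖ = ‖p - x‖ := by
        rw [← Complex.norm_conj (x - conj p), map_sub, Complex.conj_conj, hxdef, Complex.conj_ofReal, norm_sub_rev]
      rw [hxc] at h
      rw [hDdef]
      linarith
    refine ⟨⟨hre, him, hdist⟩, ⟨?_, ?_, hcdist⟩, hp0, hpv, hpcv⟩
    · rwa [Complex.conj_re]
    · rwa [Complex.conj_im, abs_neg]
  -- (A) `Φ` is constant on the upper half of the ball (★'s two-point identity, imaginary part)
  have hA : ∀ p : ℂ, ‖p - x‖ < r → 0 < p.im →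
      (lineRem f j v R p).im - ∑' i, (1 / (p - a i)).im = (lineRem f j v R z).im - ∑' i, (1 / (z - a i)).im := by
    intro p hp hpim
    obtain ⟨hpS, -, hp0, -, -⟩ := hball p hp
    obtain ⟨hsd, hid⟩ := (htwo z p hz hzim hp0 hpim).2
    have h1 : HasSum (fun i ↦ (1 / (z - a i) - 1 / (p - a i)).im) (lineRem f j v R z - lineRem f j v R p).im := by
      have h := hsd.hasSum
      rw [← hid] at h
      exact ((Complex.hasSum_iff _ _).1 h).2
    have h2 : HasSum (fun i ↦ (1 / (z - a i) - 1 / (p - a i)).im)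
        (∑' i, (1 / (z - a i)).im - ∑' i, (1 / (p - a i)).im) := by
      have h := (hsumS z hzS).hasSum.sub (hsumS p hpS).hasSum
      simpa only [Complex.sub_im] using h
    have h3 := h1.unique h2
    rw [Complex.sub_im] at h3
    linarith
  -- (B) `Φ` is reflection-odd on the ball
  have hB : ∀ p : ℂ, ‖p - x‖ < r →
      (lineRem f j v R (conj p)).im - ∑' i, (1 / (conj p - a i)).im
        = -((lineRem f j v R p).im - ∑' i, (1 / (p - a i)).im) := by
    intro p hp
    obtain ⟨hpS, hcpS, -, -, -⟩ := hball p hp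
    rw [im_lineRem_conj hE hFv hs hv0 hiso, farPull_conj hn hexp' (hsumS p hpS) (hsumS _ hcpS)]
    ring
  -- (C) `Φ` is continuous on the ball
  have hC : ContinuousOn (fun p ↦ (lineRem f j v R p).im - ∑' i, (1 / (p - a i)).im) (Metric.ball x r) := by
    have hsub : Metric.ball x r ⊆ S := fun p hp ↦ (hball p (mem_ball_iff_norm.1 hp)).1
    refine ContinuousOn.sub (fun p hp ↦ ?_) (hcontS.mono hsub)
    obtain ⟨-, -, hp0, hpv, hpcv⟩ := hball p (mem_ball_iff_norm.1 hp)
    exact (Complex.continuous_im.continuousAt.comp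
      (RhW08.GainSegment.differentiableAt_lineRem hE hiso hFv hv0 hp0 hpv hpcv).continuousAt).continuousWithinAt
  -- (D) the two one-sided limits at the real point `x = Re v`
  set Φ : ℂ → ℝ := fun p ↦ (lineRem f j v R p).im - ∑' i, (1 / (p - a i)).im with hΦdef
  set t : ℕ → ℝ := fun k ↦ r / 2 * (1 / ((k : ℝ) + 1)) with htdef
  have ht0 : ∀ k, 0 < t k := fun k ↦ by rw [htdef]; positivity
  have htr : ∀ k, t k < r := by
    intro k
    have hk : 1 / ((k : ℝ) + 1) ≤ 1 := by
      rw [div_le_one (by positivity)]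
      linarith [(Nat.cast_nonneg k : (0 : ℝ) ≤ k)]
    have : t k ≤ r / 2 := by
      rw [htdef]
      nlinarith
    linarith
  have htt : Tendsto t atTop (𝓝 0) := by
    have h := (tendsto_const_nhds (x := r / 2)).mul (tendsto_one_div_add_atTop_nhds_zero_nat (𝕜 := ℝ))
    rw [mul_zero] at h
    exact h
  set q : ℕ → ℂ := fun k ↦ x + ((t k : ℝ) : ℂ) * I with hqdef
  have hq : ∀ k, ‖q k - x‖ < r ∧ 0 < (q k).im := by
    intro k
    have hqx : q k - x = ((t k : ℝ) : ℂ) * I := by rw [hqdef]; ring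
    refine ⟨?_, ?_⟩
    · rw [hqx, norm_mul, Complex.norm_real, Complex.norm_I, mul_one, Real.norm_eq_abs, abs_of_pos (ht0 k)]
      exact htr k
    · have : (q k).im = t k := by simp [hqdef, hxdef]
      rw [this]
      exact ht0 k
  have hqt : Tendsto q atTop (𝓝 x) := by
    have h := (((Complex.continuous_ofReal.tendsto 0).comp htt).mul_const I).const_add x
    simpa using h
  have hqt' : Tendsto (fun k ↦ conj (q k)) atTop (𝓝 x) := by
    have h := (Complex.continuous_conj.tendsto x).comp hqt
    have hxx : conj x = x := by rw [hxdef, Complex.conj_ofReal]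
    rw [hxx] at h
    exact h
  have hxball : Metric.ball x r ∈ 𝓝 x := Metric.isOpen_ball.mem_nhds (Metric.mem_ball_self hr0)
  have hΦx : ContinuousAt Φ x := hC.continuousAt hxball
  have hlim1 : Tendsto (fun k ↦ Φ (q k)) atTop (𝓝 (Φ x)) := hΦx.tendsto.comp hqt
  have hlim2 : Tendsto (fun k ↦ Φ (conj (q k))) atTop (𝓝 (Φ x)) := hΦx.tendsto.comp hqt'
  have hconst1 : (fun k ↦ Φ (q k)) = fun _ ↦ Φ z := funext fun k ↦ hA (q k) (hq k).1 (hq k).2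
  have hconst2 : (fun k ↦ Φ (conj (q k))) = fun _ ↦ -Φ z := by
    funext k
    show (lineRem f j v R (conj (q k))).im - ∑' i, (1 / (conj (q k) - a i)).im
      = -((lineRem f j v R z).im - ∑' i, (1 / (z - a i)).im)
    rw [← hA (q k) (hq k).1 (hq k).2]
    exact hB (q k) (hq k).1
  rw [hconst1] at hlim1
  rw [hconst2] at hlim2
  have h1 : Φ x = Φ z := tendsto_nhds_unique hlim1 tendsto_const_nhds
  have h2 : Φ x = -Φ z := tendsto_nhds_unique hlim2 tendsto_const_nhds
  have hE' : (lineRem f j v R z).im = ∑' i, (1 / (z - a i)).im := by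
    have hΦz : Φ z = 0 := by linarith
    exact sub_eq_zero.1 hΦz
  exact ⟨hsumS z hzS, hE', fun hz' ↦ by rw [← hE', lineRem_eq_farFieldAt_of_simple hE hFv hs hv0 hiso, farFieldAt_child v hz']⟩

/-! ## §4 Pairing: reflection re-indexing of the far list, and summing a reflection-paired pointwise inequality -/

/-- ★ (K) RE-PAIRING IDENTITY for any list exported against a reflection-symmetric multiplicity `n` (the far list of ★★ is):
`Σ'ᵢ g(āᵢ) = Σ'ᵢ g(aᵢ)` for every real `g` summable both ways — how the tree's list (which carries `u` and `ū` as separate entries)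
is folded into C3's paired kernels `K_u = 1/(· − u) + 1/(· − ū)` (apply to `Re`/`Im` parts). -/
theorem tsum_conj_eq {ι : Type} {a : ι → ℂ} {n : ℂ → ℝ} (hn : ∀ c, n (conj c) = n c)
    (hexp : ∀ g : ℂ → ℝ, Summable (fun i ↦ g (a i)) → HasSum (fun c : ℂ ↦ n c * g c) (∑' i, g (a i)))
    {g : ℂ → ℝ} (hg : Summable (fun i ↦ g (a i))) (hg' : Summable (fun i ↦ g (conj (a i)))) :
    ∑' i, g (conj (a i)) = ∑' i, g (a i) := by
  rw [← (hexp g hg).tsum_eq, ← (hexp (fun c ↦ g (conj c)) hg').tsum_eq, ← Equiv.tsum_eq Complex.conjCLE.toEquiv (fun c ↦ n c * g c)]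
  refine tsum_congr fun c ↦ ?_
  show n c * g (conj c) = n (conj c) * g (conj c)
  rw [hn]

/-- ★ (K) PAIRING PRINCIPLE for any list exported against a non-negative reflection-symmetric multiplicity `n` (the far list of ★★ is:
`n(c̄) = n(c)` by `RhW08.FLinkGain.analyticOrderAt_conj_eq`): if `h(c) + h(c̄) ≤ 0` wherever `n(c) > 0`, then `Σ'ᵢ h(aᵢ) ≤ 0`.
(C3's kernel inequality (K) holds per reflection PAIR of far sources, not per source — this is how it is summed.) -/
theorem tsum_nonpos_of_paired {ι : Type} {a : ι → ℂ} {n : ℂ → ℝ} (hn0 : ∀ c, 0 ≤ n c) (hn : ∀ c, n (conj c) = n c)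
    (hexp : ∀ g : ℂ → ℝ, Summable (fun i ↦ g (a i)) → HasSum (fun c : ℂ ↦ n c * g c) (∑' i, g (a i)))
    {h : ℂ → ℝ} (hs : Summable (fun i ↦ h (a i))) (hpair : ∀ c, 0 < n c → h c + h (conj c) ≤ 0) : ∑' i, h (a i) ≤ 0 := by
  have h1 := hexp h hs
  have h2 : HasSum (fun c : ℂ ↦ n c * h (conj c)) (∑' i, h (a i)) := by
    have hh := (Complex.conjCLE.toEquiv.hasSum_iff (f := fun c : ℂ ↦ n c * h c)).2 h1
    have hfun : ((fun c : ℂ ↦ n c * h c) ∘ ⇑Complex.conjCLE.toEquiv) = fun c ↦ n c * h (conj c) := by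
      funext c
      show n (conj c) * h (conj c) = n c * h (conj c)
      rw [hn]
    rwa [hfun] at hh
  have h3 := h1.add h2
  have h4 : ∑' i, h (a i) + ∑' i, h (a i) ≤ 0 := by
    refine h3.nonpos fun c ↦ ?_
    rcases (hn0 c).eq_or_lt with h0 | h0
    · rw [← h0, zero_mul, zero_mul, add_zero]
    · rw [← mul_add]
      exact mul_nonpos_of_nonneg_of_nonpos h0.le (hpair c h0)
  linarith

end RhW08.FarPricing

end
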